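import Summits.ResolutionOfSingularities.ResolutionOfSingularities.Theorems.MarkedTransferCampaignW46PermissibleReduction
import Summits.ResolutionOfSingularities.ResolutionOfSingularities.Theorems.MarkedTransferCampaignW46LiteralCentreProcrastination
import Mathlib.Data.Fintype.Pigeonhole
import HarnessLib

/-!
# [OURS · L1 W4.6 rung (i-a)] The typed Th. 16.6 procedure on SURFACES WITH ISOLATED SINGULAR LOCUS — statement of the
# rung, its EXIT-BOUND REFORMULATION over the singular points, and the assembly (every characteristic)
# (cell res-hironaka, LADDER-RESOLUTION rung L, D-0089; campaign s46, prover res-L1-s46-pv-1; host route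
# MarkedTransfer, `--supports stmt-ResolutionOfSingularities-16155`)

HONEST FRAMING. Nothing here is a statement of H. Hironaka's manuscript (2017-03-23, [Hironaka2017]) and nothing
here asserts that any statement of it holds. Everything is OURS (campaign definitions of cell res-hironaka) or pure
logic / elementary point-set bookkeeping over the OURS typed procedure (`Theorems.MarkedTransferCampaignW46TypedProcedure`,
res-L1-type-o1) and the résumé-free reduction of `MarkedTransferCampaignW46PermissibleReduction` (this seat). The
typed candidate carriers enter only as posited résumés (through `CampaignW46.Terminates` / `TerminatesNabla`). AI
review is weaker than expert review. No `sorry`; axioms standard.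

## Why this regime (RESCUE-SEED W4.6 (i) «surfaces», read on the plane; see also the negative half)

By `not_terminates_dimLE_of_resumesCover_plane` / `not_terminatesNabla_dimLE_of_pointPlatCover_plane` (this seat,
p473754 / p475556) no termination statement about the typed procedure can hold for ALL notion instances in a regime
that contains a state with INFINITE singular locus: closed points of a curve inside `Sing(E)` can be blown up forever.
The complementary regime on surfaces is «`Sing(E)` is a finite set of closed points at every stage» (`Regime.isolatedSing`;
the K4.6 cusp family `(y^p + xⁿ, p)` lives in it, and res-L1-s46-pv-5's Moh window `Regime.mohWindowCurve` p472581
is the sub-regime where ONE blow-up resolves each point). In it every admitted centre is a single closed point of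
`Sing(E)` (`IsPermissibleCentre.exists_eq_singleton_of_isolatedSing`), the résumé plays no role in WHICH blow-ups
occur, and «hence terminates» becomes the classical statement that the configuration of infinitely near points of
an ideal `(J, b)` on a smooth surface at which the successive controlled transforms keep order `≥ b` is finite, as
long as the singular loci stay finite — every characteristic.

## Contents

* `Regime.isolatedSing`, `regimePlaneIsolated = dimLE 2 ⊓ isolatedSing` — the regime of rung (i-a).
* `PlaneIsolatedPermissiblyTerminates` — **RUNG (i-a), résumé-free form**: no infinite §2.1-permissible sequence on
  surfaces with isolated singular locus (`PermissiblyTerminates regimePlaneIsolated`); `PlaneIsolatedTerminates`,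
  `PlaneIsolatedTerminatesNabla` — the typed forms for EVERY notion instance `N` and reading `Rd`, with the proved
  implications `…_of_permissibly`, `…_of_terminates` (so the rung for the typed procedure, literal OR ∇-centred, for
  all `N`, follows from the résumé-free statement).
* `PermissibleRun.down` (the composite `Z_m → Z_0`), `sing_subset_of_transform` / `PermissibleRun.down_mem_sing`
  (**singular points only come from singular points**: `π(Sing(E′)) ⊆ Sing(E)` for a permissible step — tree theorem
  `IsBlowup.mem_support_transform_iff_of_not_mem` off the centre, `D ⊆ Sing(E)` on it).
* `LocalExitBound Rg` — **EXIT-BOUND FORM of the rung** (RELABELLED 2026-08-27, docstring-only supersede by res-L1-type-o1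
  on res-plan-2's SLOT-PLANNER WORD 01:06:33Z (1)(a); OURS-desk #40, lane B BOUNCED the label «the local statement the rung
  reduces to»): a bound `β(A, E, x)` on the number of stages of any INFINITE permissible sequence inside `Rg` whose centre
  meets the fibre over `x`. Quantified over infinite runs, it is implied by `PermissiblyTerminates Rg` with `β ≡ 0` and
  implies it in finite-`Sing` regimes (`permissiblyTerminates_of_localExitBound`, **assembly (proved)**, pigeonhole over
  `Sing(E₀)`) — an EQUIVALENT reformulation there, not a weaker local item. The genuinely local finite-sequence bound
  (rung (i-a)′ of the planner's word (1)(b): `β` bounding every FINITE permissible sequence inside `Rg`) is NOT typed here.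
* `PlaneIsolatedLocalExitBound` and `planeIsolatedPermissiblyTerminates_of_localExitBound` — the exit-bound form in the
  regime of rung (i-a), equivalent to `PlaneIsolatedPermissiblyTerminates`; what is MISSING for rung (i-a) is a proof of
  either (classically: the finiteness of the infinitely near points over `x` with controlled order `≥ b` — Zariski /
  Abhyankar quadratic-transform towers, tree `QuadraticTransforms*.lean`, `BaseTreeFinite.lean`; not yet proved here).

## References

* companion modules of this campaign (res-L1-type-o1: TypedProcedure/Anchors; this seat: PermissibleReduction,
  LiteralCentreProcrastination, ProcrastinationPlane, ProcrastinationNabla; res-L1-s46-pv-5: MohWindow).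
* H. Hironaka, ms. 2017-03-23, Th. 16.6 p.84 l.4–9, Th. 16.13 p.87 l.26–28, §2.1 p.4 l.34–39 — scope only, under
  adjudication, not cited as fact. [Hironaka2017]
* O. Zariski, P. Samuel, *Commutative Algebra* II (1960), Appendix 5 (infinitely near points on a regular surface).
  [ZariskiSamuel1960]
-/

noncomputable section

set_option linter.dupNamespace false -- mandated namespace of this single-conjunct summit

open CategoryTheory AlgebraicGeometry TopologicalSpace

namespace Summit.ResolutionOfSingularities.ResolutionOfSingularities.Theorems

namespace CampaignW46

open Literature.AlgebraicGeometry.Resolution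
open Literature.AlgebraicGeometry.Hironaka2017.S02Preliminaries
open Literature.AlgebraicGeometry.Hironaka2017.Datum
open Literature.AlgebraicGeometry.Hironaka2017.S15ARSchemes
open Literature.AlgebraicGeometry.Hironaka2017.S16Proof
open Scheme.IdealSheafData

universe u

variable {n : ℕ} {p : ℕ} [Fact p.Prime] {K : Type u} [Field K] [CharP K p]

/-! ## The regime -/

/-- [OURS · L1 W4.6 rung (i-a)] NOT a statement of the manuscript. **Regime «isolated singular locus»**, read on the
state `(Z, E)` at EVERY stage (DESIGN POINT (REG)): `Sing(E)` (row 001, `{ξ | b ≤ ord_ξ J}`) is a finite set of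
closed points of `Z` (p.4 l.34 «`Y_cl`»). [folklore] -/
def Regime.isolatedSing : Regime p K := fun A E =>
  E.sing.Finite ∧ E.sing ⊆ Literature.AlgebraicGeometry.Hironaka2017.S02Preliminaries.closedPoints A.Z

/-- [OURS · L1 W4.6 rung (i-a)] NOT a statement of the manuscript. **The regime of rung (i-a)**: surfaces
(`topologicalKrullDim Z ≤ 2`) with isolated singular locus, at every stage. [folklore] -/
def regimePlaneIsolated : Regime p K :=
  Regime.inter (Regime.dimLE 2) Regime.isolatedSing

/-- Unfolding the regime. [folklore] -/
theorem regimePlaneIsolated_iff (A : AmbientDatum p K) (E : IdealExponent A.Z) :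
    regimePlaneIsolated A E ↔
      topologicalKrullDim A.Z ≤ ((2 : ℕ) : WithBot ℕ∞) ∧ E.sing.Finite ∧
        E.sing ⊆ Literature.AlgebraicGeometry.Hironaka2017.S02Preliminaries.closedPoints A.Z :=
  Iff.rfl

/-- In the regime a §2.1-permissible centre is a single closed point of `Sing(E)`: it is irreducible and closed
inside a finite set of closed points, hence the closure of its (closed) generic point. [folklore] -/
theorem IsPermissibleCentre.exists_eq_singleton_of_isolatedSing {A : AmbientDatum p K} {E : IdealExponent A.Z}
    {D : Closeds A.Z} (hD : E.IsPermissibleCentre A.hom D) (hRg : Regime.isolatedSing A E) :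
    ∃ ξ : A.Z, ξ ∈ E.sing ∧ IsClosed ({ξ} : Set A.Z) ∧ (D : Set A.Z) = {ξ} := by
  obtain ⟨-, hcl⟩ := hRg
  have hirr := hD.irreducible
  have hgen : IsGenericPoint hirr.genericPoint (D : Set A.Z) := hirr.isGenericPoint_genericPoint D.isClosed
  have hηS : hirr.genericPoint ∈ E.sing := hD.subset_sing hgen.mem
  have hηcl : IsClosed ({hirr.genericPoint} : Set A.Z) := hcl hηS
  exact ⟨hirr.genericPoint, hηS, hηcl, hgen.def.symm.trans hηcl.closure_eq⟩

/-! ## The rung and its typed forms -/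

/-- [OURS · L1 W4.6 rung (i-a)] NOT a statement of the manuscript. **RUNG (i-a), résumé-free** — replaces the role of
the termination clause of Th. 16.13 p.87 l.26–28 («repeatedly but finitely many times») for surfaces with isolated
singular locus: there is NO infinite §2.1-permissible sequence (standard ideal exponents, permissible centres,
blow-ups, controlled transforms) all of whose stages are surfaces with finite singular locus. [folklore] -/
def PlaneIsolatedPermissiblyTerminates (p : ℕ) [Fact p.Prime] (K : Type u) [Field K] [CharP K p] : Prop :=
  PermissiblyTerminates (regimePlaneIsolated (p := p) (K := K))

/-- [OURS · L1 W4.6 rung (i-a)] NOT a statement of the manuscript. The rung for the TYPED procedure with the literal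
centre rule, for EVERY notion instance and reading: `Terminates N Rd regimePlaneIsolated`. [folklore] -/
def PlaneIsolatedTerminates (p : ℕ) [Fact p.Prime] (K : Type u) [Field K] [CharP K p] : Prop :=
  ∀ (n : ℕ) (N : Notions.{u} n) (Rd : Reading p K N), Terminates N Rd (regimePlaneIsolated (p := p) (K := K))

/-- [OURS · L1 W4.6 rung (i-a)] NOT a statement of the manuscript. The rung for the ∇-CENTRED typed procedure (the
repaired «hence terminates», `TerminatesNabla`), for EVERY notion instance and reading. [folklore] -/
def PlaneIsolatedTerminatesNabla (p : ℕ) [Fact p.Prime] (K : Type u) [Field K] [CharP K p] : Prop :=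
  ∀ (n : ℕ) (N : Notions.{u} n) (Rd : Reading p K N), TerminatesNabla N Rd (regimePlaneIsolated (p := p) (K := K))

/-- Pure logic: the résumé-free rung gives the typed rung for every `N`, `Rd`. [folklore] -/
theorem planeIsolatedTerminates_of_permissibly (h : PlaneIsolatedPermissiblyTerminates p K) :
    PlaneIsolatedTerminates p K :=
  fun _ N Rd => terminates_of_permissiblyTerminates N Rd h

/-- Pure logic: the literal-rule rung gives the ∇-centred rung. [folklore] -/
theorem planeIsolatedTerminatesNabla_of_terminates (h : PlaneIsolatedTerminates p K) :
    PlaneIsolatedTerminatesNabla p K :=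
  fun n N Rd => terminatesNabla_of_terminates (h n N Rd)

/-! ## Singular points only come from singular points -/

/-- For a blow-up `π` along the reduced ideal of a closed `D ⊆ Sing(E)`, every singular point of the transform lies
over a singular point: `π(Sing(E′)) ⊆ Sing(E)` (off `D` the singular locus is unchanged, tree theorem
`IsBlowup.mem_support_transform_iff_of_not_mem`; on `D` use `D ⊆ Sing(E)`). [folklore] -/
theorem sing_subset_of_transform {Z Z' : Scheme.{u}} [IsLocallyNoetherian Z'] {π : Z' ⟶ Z} {D : Closeds Z}
    (hπ : IsBlowup π (vanishingIdeal D)) (E : IdealExponent Z) (hD : (D : Set Z) ⊆ E.sing) {ξ' : Z'}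
    (hξ' : ξ' ∈ (E.transform π D).sing) : π ξ' ∈ E.sing := by
  by_cases h : π ξ' ∈ (D : Set Z)
  · exact hD h
  · exact (mem_sing_transform_iff_of_not_mem hπ E h).1 hξ'

namespace PermissibleRun

variable (r : PermissibleRun p K)

/-- The composite `Z_m ⟶ Z_0` of the first `m` blow-ups. [folklore] -/
def down : ∀ m : ℕ, (r.A m).Z ⟶ (r.A 0).Z
  | 0 => 𝟙 _
  | m + 1 => r.π m ≫ down m

/-- Unfolding `down (m+1)`. [folklore] -/
theorem down_succ_apply (m : ℕ) (y : (r.A (m + 1)).Z) : r.down (m + 1) y = r.down m (r.π m y) := by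
  show (r.π m ≫ r.down m) y = _
  rw [Scheme.Hom.comp_apply]

/-- Every singular point of stage `m` lies over a singular point of stage `0`. [folklore] -/
theorem down_mem_sing : ∀ (m : ℕ) (y : (r.A m).Z), y ∈ (r.E m).sing → r.down m y ∈ (r.E 0).sing
  | 0, _, hy => hy
  | m + 1, y, hy => by
    haveI : IsLocallyNoetherian (r.A (m + 1)).Z := ambient_isLocallyNoetherian _
    rw [down_succ_apply]
    refine down_mem_sing m _ ?_
    rw [r.E_succ m] at hy
    exact sing_subset_of_transform (r.blowup m) (r.E m) (r.permissible m).subset_sing hy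

/-- Every centre is non-empty. [folklore] -/
theorem centre_nonempty (m : ℕ) : ((r.D m : Set (r.A m).Z)).Nonempty :=
  (r.permissible m).irreducible.nonempty

end PermissibleRun

/-! ## The local exit bound and the assembly -/

/-- [OURS · L1 W4.6 rung (i-a)] NOT a statement of the manuscript. **LOCAL EXIT BOUND in the regime `Rg` — EXIT-BOUND
FORM, EQUIVALENT to `PermissiblyTerminates Rg` in every finite-`Sing` regime**: there is a function `β(A, E, x)` of a state
and a point such that, for EVERY INFINITE §2.1-permissible sequence inside `Rg` and every point `x` of its stage `0`, any
finite set of stages whose centre meets the fibre over `x` has at most `β(A₀, E₀, x)` elements. (For point centres: at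
most `β` of the blown-up points are infinitely near to `x`.) RELABEL (docstring-only supersede 2026-08-27, res-L1-type-o1 on
res-plan-2's SLOT-PLANNER WORD 01:06:33Z (1)(a), OURS-desk #40 A≠B: lane B res-L1-ref-b2 00:46:25Z BOUNCED the earlier label):
because the bound is quantified over INFINITE runs `r : PermissibleRun`, `PermissiblyTerminates Rg → LocalExitBound Rg`
holds with `β ≡ 0` (no infinite run in the regime ⇒ the clause is vacuous), and `permissiblyTerminates_of_localExitBound`
gives the converse in finite-`Sing` regimes — so this decl is an exit-bound REFORMULATION of the rung, NOT a weaker local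
statement it «reduces to»; the genuinely local item (a bound `β` for every FINITE permissible sequence inside `Rg`, rung
(i-a)′ of the slot planner's word (1)(b)) is NOT typed here. Lean term unchanged. [folklore] -/
def LocalExitBound (Rg : Regime p K) : Prop :=
  ∃ β : ∀ A : AmbientDatum p K, IdealExponent A.Z → A.Z → ℕ,
    ∀ r : PermissibleRun p K, (∀ k, Rg (r.A k) (r.E k)) →
      ∀ (x : (r.A 0).Z) (s : Finset ℕ),
        (∀ m ∈ s, ∃ y ∈ (r.D m : Set (r.A m).Z), r.down m y = x) → s.card ≤ β (r.A 0) (r.E 0) x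

/-- **Assembly (pigeonhole).** [OURS · L1 W4.6 rung (i-a)] NOT a statement of the manuscript. In a regime all of whose
states have finite singular locus, a local exit bound excludes infinite permissible sequences: the centres of an
infinite sequence lie over the finitely many singular points of stage `0`, so infinitely many of them lie over one
point `x`, contradicting the bound `β(A₀, E₀, x)`. [folklore] -/
theorem permissiblyTerminates_of_localExitBound {Rg : Regime p K}
    (hfin : ∀ (A : AmbientDatum p K) (E : IdealExponent A.Z), Rg A E → E.sing.Finite)
    (hL : LocalExitBound Rg) : PermissiblyTerminates Rg := by
  classical
  intro r hr
  obtain ⟨β, hβ⟩ := hL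
  -- a point of each centre, and its image in `Sing(E₀)`
  choose y hy using r.centre_nonempty
  have hg : ∀ m, r.down m (y m) ∈ (r.E 0).sing := fun m =>
    r.down_mem_sing m (y m) ((r.permissible m).subset_sing (hy m))
  haveI : Finite (r.E 0).sing := (hfin _ _ (hr 0)).to_subtype
  let g : ℕ → (r.E 0).sing := fun m => ⟨r.down m (y m), hg m⟩
  -- infinitely many stages over one point `x`
  obtain ⟨x, hx⟩ := Finite.exists_infinite_fiber g
  have hinf : (g ⁻¹' {x} : Set ℕ).Infinite := Set.infinite_coe_iff.mp hx
  obtain ⟨s, hs, hcard⟩ := hinf.exists_subset_card_eq (β (r.A 0) (r.E 0) x.1 + 1)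
  have hle := hβ r hr x.1 s fun m hm => ⟨y m, hy m, by
    have : g m = x := hs hm
    exact congrArg Subtype.val this⟩
  omega

/-- [OURS · L1 W4.6 rung (i-a)] NOT a statement of the manuscript. The exit-bound form `LocalExitBound` in the regime of
surfaces with isolated singular locus — an EXIT-BOUND FORM EQUIVALENT to `PlaneIsolatedPermissiblyTerminates` (the regime is
finite-`Sing`: `→` is `planeIsolatedPermissiblyTerminates_of_localExitBound`, `←` holds with `β ≡ 0`); the local
finite-sequence bound is NOT typed here (RELABEL, docstring-only supersede 2026-08-27 per res-plan-2 01:06:33Z (1)(a) /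
OURS-desk #40; the earlier label «what rung (i-a) reduces to» is withdrawn). Lean term unchanged. [folklore] -/
def PlaneIsolatedLocalExitBound (p : ℕ) [Fact p.Prime] (K : Type u) [Field K] [CharP K p] : Prop :=
  LocalExitBound (regimePlaneIsolated (p := p) (K := K))

/-- **Rung (i-a) from the exit-bound form** (one direction of the equivalence recorded on `LocalExitBound`). [folklore] -/
theorem planeIsolatedPermissiblyTerminates_of_localExitBound (h : PlaneIsolatedLocalExitBound p K) :
    PlaneIsolatedPermissiblyTerminates p K :=
  permissiblyTerminates_of_localExitBound (fun _ _ hRg => hRg.2.1) h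

/-- **The typed rungs from the exit-bound form** (all notion instances, both centre rules). [folklore] -/
theorem planeIsolatedTerminatesNabla_of_localExitBound (h : PlaneIsolatedLocalExitBound p K) :
    PlaneIsolatedTerminates p K ∧ PlaneIsolatedTerminatesNabla p K :=
  have hT := planeIsolatedTerminates_of_permissibly (planeIsolatedPermissiblyTerminates_of_localExitBound h)
  ⟨hT, planeIsolatedTerminatesNabla_of_terminates hT⟩

end CampaignW46

end Summit.ResolutionOfSingularities.ResolutionOfSingularities.Theorems

end
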